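import Summits.Ventures.WeilGRH.TwistedOddParityTailEven
import Summits.Ventures.WeilGRH.TwistedOddParityFar
import Summits.Ventures.WeilGRH.TwistedDataRung
import HarnessLib

/-!
# GRH arm (rh-explicit, venture WeilGRH): twisted format C for an ODD REAL character — the DATA-ONLY front door with the
  parity bonus kept (hybrid: even sector on the parity-1 kernel, odd sector on the parity-0 kernel)

Cell `rh-explicit`, WEIL TRACK — GRH ARM (lit/typing seat weil-grh-5 gen11; weil-grh-2 gen7's ASK, INBOX 2026-08-23T09:30Z /
STATUS 1 (2): with the parity-0 kernel the even-sector form of every small odd conductor is NEGATIVE; with weil-grh-1's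
parity-1 kernel `twistedGramCoeffOdd χ a = twistedGramCoeff χ a + πδ − sechIncrCoeff a` all odd cells close at order 1).
The rung needs both SectorSplit forms of `twistedGramCoeffOdd` nonnegative for every `N`
(`weilPositivityOnChar_of_twistedGramCoeffOdd_sector_psd`).  EVEN sector: format C on the parity-1 kernel itself — far
coercivity `twistedGramCoeffOdd_even_far_ge_diag` (`TwistedOddParityFar.lean`), exact columns with weights, and the typed
tail majorant `oddParity_even_tail_majorant_matrix` (`TwistedOddParityTailEven.lean`: parity-0 majorant, Peter–Paul `θ'`,
plus the `sech` diagonal `(1+θ'⁻¹)·B(8a/(3π²))²/(3d₀(B₃−1)³)·I`).  ODD sector: the bonus block is PSD there too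
(`sechBonus_oddSector_nonneg`), so the parity-0 odd-sector certificate of `TwistedDataRung.lean` (kernel `twistedGramCoeff`,
all inputs typed) suffices.

* `weilPositivityOnChar_of_twistedOdd_formatC_dataFull` — `q ≠ 1`, `conj χ = χ`, `a_χ = 1`, `a > 0`; EVEN sector (kernel
  `twistedGramCoeffOdd`): `B⁺ ≥ 2`, `2B⁺ ≤ B₃⁺`, `θ⁺, θ'⁺ > 0`, weights `w⁺`, sign facts `h0e`, `hd0e`, `hwe`, certificate
  `hSe`; ODD sector (kernel `twistedGramCoeff`): exactly the odd half of `weilPositivityOnChar_of_twisted_formatC_data`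
  ⟹ `WeilPositivityOnChar χ a`.  Every premise is a finite real inequality or one PSD check; the `sech` entries of the
  even block / columns are regular integrals the enclosure layer evaluates (`σ` has Taylor radius `π > 2a`).

No definitions; no named facts; RH/GRH-free; standard axioms.
-/

set_option autoImplicit false

noncomputable section

open Complex Finset Matrix
open scoped Real BigOperators ComplexConjugate ArithmeticFunction.vonMangoldt

namespace Summit.Ventures.WeilGRH

open Literature.NumberTheory.LFunctions
open Literature.NumberTheory.LFunctions.Yoshida1992 (freq incrCoeff archCoeff archExpSumSin)
open Literature.Analysis.SpecialFunctions
open Summit.RiemannHypothesis.RiemannHypothesis.Theorems.WeilFormatC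

variable {q : ℕ} {a : ℝ}

section Rung

/-- **Twisted format C for an odd real character, data-only, parity bonus kept (hybrid door).**  See the module docstring. -/
theorem weilPositivityOnChar_of_twistedOdd_formatC_dataFull (hq : q ≠ 1) (χ : DirichletCharacter ℂ q)
    (hχ : ∀ n : ℕ, conj (χ (n : ZMod q)) = χ (n : ZMod q)) (hodd : charParity χ = 1) (ha : 0 < a)
    -- EVEN sector data
    {Be B3e : ℕ} (hBe : 2 ≤ Be) (hBBe : 2 * Be ≤ B3e) {θe θe' d0e : ℝ} (hθe : 0 < θe) (hθe' : 0 < θe') (we : ℕ → ℝ)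
    (h0e : 0 < ((reDigammaQuarter (freq a Be) - Real.log π + Real.log q) / 2 - a * (1 + weilArchDensity (2 * a)) / (π ^ 2 * Be ^ 2) - 1 / (8 * Be) - a * (1 + weilArchDensity (2 * a)) / π ^ 2 * Real.sqrt (8 / ((Be - 1 : ℕ) : ℝ)) - (∑ k ∈ weilPrimeIndex a, (Λ k : ℝ) / Real.sqrt k * (2 * Real.cos (π / (⌊2 * a / Real.log k⌋₊ + 2)))) / 2))
    (hd0e : 0 < d0e ∧ d0e ≤ ((reDigammaQuarter (freq a B3e) - Real.log π + Real.log q) / 2 - a * (1 + weilArchDensity (2 * a)) / (π ^ 2 * B3e ^ 2) - 1 / (8 * B3e) - a * (1 + weilArchDensity (2 * a)) / π ^ 2 * Real.sqrt (8 / ((Be - 1 : ℕ) : ℝ)) - (∑ k ∈ weilPrimeIndex a, (Λ k : ℝ) / Real.sqrt k * (2 * Real.cos (π / (⌊2 * a / Real.log k⌋₊ + 2)))) / 2))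
    (hwe : ∀ m, Be ≤ m → m < B3e → 0 < we m ∧ we m ≤ ((reDigammaQuarter (freq a m) - Real.log π + Real.log q) / 2 - a * (1 + weilArchDensity (2 * a)) / (π ^ 2 * m ^ 2) - 1 / (8 * m) - a * (1 + weilArchDensity (2 * a)) / π ^ 2 * Real.sqrt (8 / ((Be - 1 : ℕ) : ℝ)) - (∑ k ∈ weilPrimeIndex a, (Λ k : ℝ) / Real.sqrt k * (2 * Real.cos (π / (⌊2 * a / Real.log k⌋₊ + 2)))) / 2))
    (hSe : ∀ x : Fin Be → ℝ, 0 ≤ ∑ i, ∑ j, x i * x j *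
      ((if (i : ℕ) = 0 then twistedGramCoeffOdd χ a 0 j else if (j : ℕ) = 0 then twistedGramCoeffOdd χ a i 0 else (twistedGramCoeffOdd χ a i j + twistedGramCoeffOdd χ a i (-(j : ℤ))) / 2)
        - (∑ m ∈ Finset.Ico Be B3e, (if (i : ℕ) = 0 then twistedGramCoeffOdd χ a 0 m else if m = 0 then twistedGramCoeffOdd χ a i 0 else (twistedGramCoeffOdd χ a i m + twistedGramCoeffOdd χ a i (-(m : ℤ))) / 2) * (if (j : ℕ) = 0 then twistedGramCoeffOdd χ a 0 m else if m = 0 then twistedGramCoeffOdd χ a j 0 else (twistedGramCoeffOdd χ a j m + twistedGramCoeffOdd χ a j (-(m : ℤ))) / 2) / we m)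
        - ((1 + θe') * ((1 + θe) * ((1 + 4 / π * (∑ k ∈ weilPrimeIndex a, (Λ k : ℝ) / Real.sqrt k)) / 4) ^ 2 / (d0e * ((B3e - 1 : ℕ) : ℝ)) * ((-1 : ℝ) ^ (i : ℕ) * (-1 : ℝ) ^ (j : ℕ)) + (if i = j then (1 + θe⁻¹) * (Be / (d0e * ((B3e : ℝ) ^ 2 * ((B3e - 1 : ℕ) : ℝ)))) * (2 * (i : ℕ) * (∑ k ∈ weilPrimeIndex a, (Λ k : ℝ) / Real.sqrt k) / π + (((i : ℕ) : ℝ) / 2 + 8 * a * (1 + weilArchDensity (2 * a)) / (3 * π ^ 2))) ^ 2 else 0)) + (if i = j then (1 + θe'⁻¹) * ((Be : ℝ) * (8 * a / (3 * π ^ 2)) ^ 2 / (3 * d0e * (((B3e - 1 : ℕ) : ℝ)) ^ 3)) else 0))))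
    -- ODD sector data
    {Bo B3o : ℕ} (hBo : 1 ≤ Bo) (hBBo : 2 * Bo ≤ B3o) {θo d0o : ℝ} (hθo : 0 < θo) (wo : ℕ → ℝ)
    (h0o : 0 < ((reDigammaQuarter (freq a ((Bo : ℤ) + 1)) - Real.log π + Real.log q) / 2 - 1 / (8 * ((Bo : ℝ) + 1)) - a * (1 + weilArchDensity (2 * a)) / (π ^ 2 * ((Bo : ℝ) + 1) ^ 2)) - π / 4 - a * (1 + weilArchDensity (2 * a)) / π ^ 2 * Real.sqrt (8 / Bo) - (∑ k ∈ weilPrimeIndex a, (Λ k : ℝ) / Real.sqrt k * (2 * Real.cos (π / (⌊2 * a / Real.log k⌋₊ + 2)))) / 2)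
    (hd0o : 0 < d0o ∧ d0o ≤ ((reDigammaQuarter (freq a ((B3o : ℤ) + 1)) - Real.log π + Real.log q) / 2 - 1 / (8 * ((B3o : ℝ) + 1)) - a * (1 + weilArchDensity (2 * a)) / (π ^ 2 * ((B3o : ℝ) + 1) ^ 2)) - π / 4 - a * (1 + weilArchDensity (2 * a)) / π ^ 2 * Real.sqrt (8 / Bo) - (∑ k ∈ weilPrimeIndex a, (Λ k : ℝ) / Real.sqrt k * (2 * Real.cos (π / (⌊2 * a / Real.log k⌋₊ + 2)))) / 2)
    (hwo : ∀ l, Bo ≤ l → l < B3o → 0 < wo l ∧ wo l ≤ ((reDigammaQuarter (freq a ((l : ℤ) + 1)) - Real.log π + Real.log q) / 2 - 1 / (8 * ((l : ℝ) + 1)) - a * (1 + weilArchDensity (2 * a)) / (π ^ 2 * ((l : ℝ) + 1) ^ 2) - (π / 2 - Real.arctan (Real.sqrt Bo / Real.sqrt ((l : ℝ) + 1))) / 2 - a * (1 + weilArchDensity (2 * a)) / π ^ 2 * Real.sqrt (8 / Bo) - (∑ k ∈ weilPrimeIndex a, (Λ k : ℝ) / Real.sqrt k * (2 * Real.cos (π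 / (⌊2 * a / Real.log k⌋₊ + 2)))) / 2))
    (hSo : ∀ x : Fin Bo → ℝ, 0 ≤ ∑ k, ∑ k', x k * x k' *
      (((twistedGramCoeff χ a (((k : ℕ) : ℤ) + 1) (((k' : ℕ) : ℤ) + 1) - twistedGramCoeff χ a (((k : ℕ) : ℤ) + 1) (-(((k' : ℕ) : ℤ) + 1))) / 2)
        - (∑ l ∈ Finset.Ico Bo B3o, ((twistedGramCoeff χ a (((k : ℕ) : ℤ) + 1) ((l : ℤ) + 1) - twistedGramCoeff χ a (((k : ℕ) : ℤ) + 1) (-((l : ℤ) + 1))) / 2) * ((twistedGramCoeff χ a (((k' : ℕ) : ℤ) + 1) ((l : ℤ) + 1) - twistedGramCoeff χ a (((k' : ℕ) : ℤ) + 1) (-((l : ℤ) + 1))) / 2) / wo l)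
        - ((1 + θo) * (1 / (d0o * B3o)) * (((-1 : ℝ) ^ ((k : ℕ) + 1) * (-(∑ j ∈ weilPrimeIndex a, (χ (j : ZMod q)).re * ((Λ j : ℝ) / Real.sqrt j) * Real.sin (freq a (((k : ℕ) : ℤ) + 1) * Real.log j)) / π - (Complex.digamma (1 / 4 + ((freq a (((k : ℕ) : ℤ) + 1) : ℝ) : ℂ) / 2 * I)).im / (2 * π) + archExpSumSin a (((k : ℕ) : ℤ) + 1) / π)) * ((-1 : ℝ) ^ ((k' : ℕ) + 1) * (-(∑ j ∈ weilPrimeIndex a, (χ (j : ZMod q)).re * ((Λ j : ℝ) / Real.sqrt j) * Real.sin (freq a (((k' : ℕ) : ℤ) + 1) * Real.log j)) / π - (Complex.digamma (1 / 4 + ((freq a (((k' : ℕ) : ℤ) + 1) : ℝ) : ℂ) / 2 * I)).im / (2 * π) + archExpSumSin a (((k' : ℕ) : ℤ) + 1) / π))) + (if k = k' then (1 + θo⁻¹) * (Bo / (d0o * ((((B3o : ℝ) + 1) ^ 2) * (B3o : ℝ)))) * (2 * ((k : ℕ) + 1 : ℕ) * (∑ j ∈ weilPrimeIndex a, (Λ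 j : ℝ) / Real.sqrt j) / π + ((((k : ℕ) + 1 : ℕ) : ℝ) / 2 + 4 * a * (1 + weilArchDensity (2 * a)) / (3 * π ^ 2))) ^ 2 else 0)))) :
    WeilPositivityOnChar χ a := by
  have hE0 : 0 < weilArchDensity (2 * a) := weilArchDensity_pos (by positivity)
  have hC : 0 ≤ a * (1 + weilArchDensity (2 * a)) := by positivity
  -- the sector kernels and far diagonals as functions
  set Mev : ℕ → ℕ → ℝ := fun i j ↦ (if i = 0 then twistedGramCoeffOdd χ a 0 j else if j = 0 then twistedGramCoeffOdd χ a i 0 else (twistedGramCoeffOdd χ a i j + twistedGramCoeffOdd χ a i (-(j : ℤ))) / 2) with hMev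
  set Mod : ℕ → ℕ → ℝ := fun k l ↦ ((twistedGramCoeff χ a ((k : ℤ) + 1) ((l : ℤ) + 1) - twistedGramCoeff χ a ((k : ℤ) + 1) (-((l : ℤ) + 1))) / 2) with hMod
  set dev : ℕ → ℝ := fun m ↦ ((reDigammaQuarter (freq a m) - Real.log π + Real.log q) / 2 - a * (1 + weilArchDensity (2 * a)) / (π ^ 2 * m ^ 2) - 1 / (8 * m) - a * (1 + weilArchDensity (2 * a)) / π ^ 2 * Real.sqrt (8 / ((Be - 1 : ℕ) : ℝ)) - (∑ k ∈ weilPrimeIndex a, (Λ k : ℝ) / Real.sqrt k * (2 * Real.cos (π / (⌊2 * a / Real.log k⌋₊ + 2)))) / 2) with hdev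
  set dod : ℕ → ℝ := fun l ↦ ((reDigammaQuarter (freq a ((l : ℤ) + 1)) - Real.log π + Real.log q) / 2 - 1 / (8 * ((l : ℝ) + 1)) - a * (1 + weilArchDensity (2 * a)) / (π ^ 2 * ((l : ℝ) + 1) ^ 2) - (π / 2 - Real.arctan (Real.sqrt Bo / Real.sqrt ((l : ℝ) + 1))) / 2 - a * (1 + weilArchDensity (2 * a)) / π ^ 2 * Real.sqrt (8 / Bo) - (∑ k ∈ weilPrimeIndex a, (Λ k : ℝ) / Real.sqrt k * (2 * Real.cos (π / (⌊2 * a / Real.log k⌋₊ + 2)))) / 2) with hdod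
  have hsymm := twistedGramCoeff_comm χ a
  have hrefl := twistedGramCoeff_neg_neg χ a
  have hsymm1 := twistedGramCoeffOdd_comm χ a
  have hrefl1 := twistedGramCoeffOdd_neg_neg χ a
  refine weilPositivityOnChar_of_twistedGramCoeffOdd_sector_psd hq χ hχ hodd ha ?_ ?_
  · -- EVEN sector
    intro K y
    have hB3e : 2 ≤ B3e := by omega
    have hB3e1 : 1 ≤ B3e := by omega
    have hBe1 : 1 ≤ Be := by omega
    have hd : ∀ m, Be ≤ m → 0 < dev m := fun m hm ↦ by
      simp only [hdev]
      have h := even_dhat_core_mono ha hC hBe1 hm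
      linarith
    have hdmono : ∀ m, B3e ≤ m → d0e ≤ dev m := fun m hm ↦ by
      simp only [hdev]
      have h := even_dhat_core_mono ha hC hB3e1 hm
      linarith [hd0e.2]
    have hfar : ∀ (N : ℕ) (y : ℕ → ℝ),
        ∑ n ∈ Finset.Ico Be N, dev n * y n ^ 2 ≤ ∑ n ∈ Finset.Ico Be N, ∑ m ∈ Finset.Ico Be N, y n * Mev n m * y m :=
      fun N y ↦ by
        simp only [hdev, hMev]
        exact twistedGramCoeffOdd_even_far_ge_diag χ ha hBe N y
    have hU1 : ∀ x : Fin Be → ℝ,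
        ∑ m ∈ Finset.Ico Be B3e, (∑ i : Fin Be, Mev i m * x i) ^ 2 / dev m
          ≤ x ⬝ᵥ (Matrix.of fun i j : Fin Be ↦ ∑ m ∈ Finset.Ico Be B3e, Mev i m * Mev j m / we m) *ᵥ x :=
      fun x ↦ columns_majorant (Finset.Ico Be B3e) (fun m i ↦ Mev i m) dev we
        (fun m hm ↦ by
          have hm := Finset.mem_Ico.mp hm
          have h := hwe m hm.1 hm.2
          simp only [hdev]
          exact h) x
    have hU2 := fun (N : ℕ) (x : Fin Be → ℝ) ↦
      oddParity_even_tail_majorant_matrix χ ha hBBe hB3e dev hd0e.1 hdmono hθe hθe' N x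
    have key := sum_range_mul_mul_nonneg_of_certificate_sum_split Mev
      (fun n m ↦ evenKernel_symm (twistedGramCoeffOdd χ a) hsymm1 hrefl1 n m)
      Be B3e (by omega) dev _ _ hd hfar hU1 (fun N x ↦ by
        have h := hU2 N x
        simp only [hMev, hdev] at h ⊢
        exact h) (fun x ↦ by
        have h := hSe x
        simp only [hMev, Matrix.of_apply] at h ⊢
        exact h) (K + 1) y
    simpa only [hMev] using key
  · -- ODD sector
    intro K z
    have hB3o : 1 ≤ B3o := by omega
    have hd : ∀ l, Bo ≤ l → 0 < dod l := fun l hl ↦ by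
      simp only [hdod]
      have h := odd_dhat_core_mono ha hC hl
      have hpen := hilbert_atan_penalty_le Bo l
      linarith
    have hdlow : ∀ l, B3o ≤ l → d0o ≤ dod l := fun l hl ↦ by
      simp only [hdod]
      have h := odd_dhat_core_mono ha hC hl
      have hpen := hilbert_atan_penalty_le Bo l
      linarith [hd0o.2]
    have hfar : ∀ (N : ℕ) (z : ℕ → ℝ),
        ∑ k ∈ Finset.Ico Bo N, dod k * z k ^ 2 ≤ ∑ k ∈ Finset.Ico Bo N, ∑ l ∈ Finset.Ico Bo N, z k * Mod k l * z l :=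
      fun N z ↦ by
        simp only [hdod, hMod]
        exact twistedGramCoeff_odd_far_ge_diag_atan χ ha hBo N z
    have hU1 : ∀ x : Fin Bo → ℝ,
        ∑ l ∈ Finset.Ico Bo B3o, (∑ k : Fin Bo, Mod k l * x k) ^ 2 / dod l
          ≤ x ⬝ᵥ (Matrix.of fun k k' : Fin Bo ↦ ∑ l ∈ Finset.Ico Bo B3o, Mod k l * Mod k' l / wo l) *ᵥ x :=
      fun x ↦ columns_majorant (Finset.Ico Bo B3o) (fun l k ↦ Mod k l) dod wo
        (fun l hl ↦ by
          have hl := Finset.mem_Ico.mp hl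
          have h := hwo l hl.1 hl.2
          simp only [hdod]
          exact h) x
    have hU2 := fun (N : ℕ) (x : Fin Bo → ℝ) ↦
      odd_twisted_tail_majorant_matrix χ ha hBBo hB3o dod hd0o.1 hdlow hθo N x
    have key := sum_range_mul_mul_nonneg_of_certificate_sum_split Mod
      (fun k l ↦ oddKernel_symm (twistedGramCoeff χ a) hsymm hrefl k l)
      Bo B3o (by omega) dod _ _ hd hfar hU1 (fun N x ↦ by
        have h := hU2 N x
        simp only [hMod, hdod] at h ⊢
        exact h) (fun x ↦ by
        have h := hSo x
        simp only [hMod, Matrix.of_apply] at h ⊢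
        exact h) K z
    have key' : 0 ≤ ∑ k ∈ Finset.range K, ∑ l ∈ Finset.range K, z k * z l * Mod k l := by
      simpa only [hMod] using key
    have hbonus := sechBonus_oddSector_nonneg ha K z
    have e : ∑ k ∈ Finset.range K, ∑ l ∈ Finset.range K, z k * z l * ((twistedGramCoeffOdd χ a ((k : ℤ) + 1) ((l : ℤ) + 1) -
            twistedGramCoeffOdd χ a ((k : ℤ) + 1) (-((l : ℤ) + 1))) / 2)
        = (∑ k ∈ Finset.range K, ∑ l ∈ Finset.range K, z k * z l * Mod k l)
          + ∑ k ∈ Finset.range K, ∑ l ∈ Finset.range K, z k * z l * ((((if ((k : ℤ) + 1) = ((l : ℤ) + 1) then π else 0) - sechIncrCoeff a ((k : ℤ) + 1) ((l : ℤ) + 1))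
            - ((if ((k : ℤ) + 1) = -((l : ℤ) + 1) then π else 0) - sechIncrCoeff a ((k : ℤ) + 1) (-((l : ℤ) + 1)))) / 2) := by
      rw [← Finset.sum_add_distrib]
      refine Finset.sum_congr rfl fun k _ ↦ ?_
      rw [← Finset.sum_add_distrib]
      refine Finset.sum_congr rfl fun l _ ↦ ?_
      simp only [hMod]
      unfold twistedGramCoeffOdd
      ring
    rw [e]
    exact add_nonneg key' hbonus

end Rung

end Summit.Ventures.WeilGRH

end
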